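import Summits.FinalStateConjecture.FinalStateConjecture.Statement
import Summits.FinalStateConjecture.FinalStateConjecture.Theorems.PhotonSphereChannelsEndVisibleTransport
import Literature.Geometry.Lorentzian.CauchyDevelopment
import Literature.Geometry.Lorentzian.NullInfinity
import Literature.Geometry.Lorentzian.Isometry
import HarnessLib

/-!
# Normalised null rays correspond under an isometry of developments (registered stub
`stub_rayTransport`, line `Sketch` = tame template, crux `EIHFluxBalance.ModulatedKerrHandoff`,
item stmt-FinalStateConjecture-17402)

Let `𝒟₁`, `𝒟₂` be vacuum Cauchy developments of the same initial data set `D` on `X`, and let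
`ψ : M₁ ≃ M₂` be a time-orientation preserving isometric diffeomorphism with `ψ ∘ ι₁ = ι₂` (the
data of `CauchyDevelopment.IsIsometricTo`, i.e. of MGHD uniqueness up to isometry,
Choquet-Bruhat–Geroch 1969). Then for every `p : X`, every curve `γ : ℝ → M₁` and every parameter
domain `dom`, **`ψ ∘ γ` is a normalised future null ray of `𝒟₂` from `p` on `dom` iff `γ` is a
normalised future null ray of `𝒟₁` from `p` on `dom`** (`LorentzianMetric.IsNormalisedNullRayFrom`:
maximal geodesic on `dom ∋ 0`, `γ 0 = ι p`, null future-directed initial velocity normalised by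
`g(γ' 0, ν p) = -1` against the future unit normal of the data hypersurface).

Both directions are the one-way transport
`Theorems.EndVisible.isNormalisedNullRayFrom_comp` (`Theorems/PhotonSphereChannelsEndVisibleTransport`:
geodesics to geodesics under isometric immersions, O'Neill 1983, pp. 90–91; maximality by pulling an
extension back along the inverse; `g₂(dψ u, dψ w) = g₁(u, w)`; the timecone is preserved;
`dψ ν₁ = ν₂`, `DataEmbedding.mfderiv_normal`): (⇐) for the package `(ψ, ψ⁻¹)`, (⇒) for the inverse
package `(ψ⁻¹, ψ)` (`Theorems.EndVisible.symm_package`: `ψ⁻¹` is an isometric immersion, preserves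
the time orientations, `ψ⁻¹ ∘ ι₂ = ι₁`) applied to the curve `ψ ∘ γ`, using `ψ⁻¹ ∘ (ψ ∘ γ) = γ`.
Mathlib + the Literature cone + `Theorems/PhotonSphereChannelsEndVisibleTransport` only; no
definitions, no named facts. O'Neill, *Semi-Riemannian geometry* (1983), Ch. 3, pp. 90–91;
Sbierski, Ann. Henri Poincaré 17 (2016), §2, §3.1.
Stub-worker of the line lead prover-line-stmt-FinalStateConjecture-17402-0, 2026-08-17.
-/

-- the summit-side namespace `Summit.FinalStateConjecture.FinalStateConjecture.…` (summit = problem)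
-- repeats a component by design, which the `dupNamespace` linter would flag on every decl.
set_option linter.dupNamespace false

noncomputable section

open scoped Manifold ContDiff Topology
open Set Function Literature.Geometry.Lorentzian

namespace Summit.FinalStateConjecture.FinalStateConjecture.Theorems.EIHFluxBalance.TameTemplate

/-- **Normalised null rays correspond under an isometry of developments** (registered stub
`stub_rayTransport` of line `Sketch`). For vacuum Cauchy developments `𝒟₁`, `𝒟₂` of `D` and a
time-orientation preserving isometric diffeomorphism `ψ : M₁ ≃ M₂` with `ψ ∘ ι₁ = ι₂`: `ψ ∘ γ` is a
normalised future null ray of `𝒟₂` from `p` on `dom` iff `γ` is one of `𝒟₁`. (⇐) is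
`EndVisible.isNormalisedNullRayFrom_comp` for `(ψ, ψ⁻¹)`; (⇒) is the same lemma for the inverse
package `(ψ⁻¹, ψ)` (`EndVisible.symm_package`) and the curve `ψ ∘ γ`, as `ψ⁻¹ ∘ (ψ ∘ γ) = γ`.
[cite: ONeillSemiRiemannian1983, Ch. 3, pp. 90–91] -/
theorem stub_rayTransport : ∀ (X : Type) [TopologicalSpace X] [ChartedSpace E3 X] [IsManifold (𝓡 3) ((⊤ : ℕ∞) : WithTop ℕ∞) X] [T2Space X] [SecondCountableTopology X] [ConnectedSpace X] (D : InitialDataSet (𝓡 3) X) (𝒟₁ 𝒟₂ : VacuumCauchyDevelopment D) (ψ : Diffeomorph (𝓡 4) (𝓡 4) 𝒟₁.carrier 𝒟₂.carrier ((⊤ : ℕ∞) : WithTop ℕ∞)), 𝒟₁.metric.IsIsometry 𝒟₂.metric.toPseudoRiemannianMetric ψ → 𝒟₁.timeOrientation.PreservesTimeOrientation ψ 𝒟₂.timeOrientation → ψ ∘ 𝒟₁.embed = 𝒟₂.embed → ∀ [𝒟₁.metric.HasLeviCivita] [𝒟₂.metric.HasLeviCivita] (p : X) (γ : ℝ → 𝒟₁.carrier)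 (dom : Set ℝ), 𝒟₂.metric.IsNormalisedNullRayFrom 𝒟₂.timeOrientation 𝒟₂.embed 𝒟₂.normal p (ψ ∘ γ) dom ↔ 𝒟₁.metric.IsNormalisedNullRayFrom 𝒟₁.timeOrientation 𝒟₁.embed 𝒟₁.normal p γ dom := by
  intro X _ _ _ _ _ _ D 𝒟₁ 𝒟₂ ψ hiso hτ hι _ _ p γ dom
  -- the inverse package `(ψ⁻¹ isometric immersion, ψ⁻¹ preserves time orientation, ψ⁻¹ ∘ ι₂ = ι₁)`
  obtain ⟨hφ', hτ', hι'⟩ := EndVisible.symm_package (𝒟₁ := 𝒟₁.toCauchyDevelopment)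
    (𝒟₂ := 𝒟₂.toCauchyDevelopment) ψ hiso hτ hι
  have hφ : 𝒟₁.metric.IsIsometricImmersion 𝒟₂.metric.toPseudoRiemannianMetric ψ :=
    ⟨ψ.contMDiff, hiso⟩
  refine ⟨fun h ↦ ?_, fun h ↦
    EndVisible.isNormalisedNullRayFrom_comp hφ hφ' ψ.symm_apply_apply hτ hι h⟩
  -- (⇒): pull `ψ ∘ γ` back along `ψ⁻¹`
  have hγ : (ψ.symm : 𝒟₂.carrier → 𝒟₁.carrier) ∘ ((ψ : 𝒟₁.carrier → 𝒟₂.carrier) ∘ γ) = γ :=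
    funext fun t ↦ ψ.symm_apply_apply (γ t)
  have h₁ := EndVisible.isNormalisedNullRayFrom_comp hφ' hφ ψ.apply_symm_apply hτ' hι' h
  rwa [hγ] at h₁

end Summit.FinalStateConjecture.FinalStateConjecture.Theorems.EIHFluxBalance.TameTemplate

end
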